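import Literature.AnabelianGeometry.SemiGraphs.TemperedCompactInVerticialOfLevelData
import Literature.AnabelianGeometry.SemiGraphs.TemperedChartTransport
import Literature.AnabelianGeometry.SemiGraphs.TemperedVerticialNamedFactsProofs
import HarnessLib

/-!
# [SemiAnbd] Theorem 3.7 (iii) from the finite-level data of ONE chart

Mochizuki, *Semi-graphs of anabelioids*, Publ. RIMS **42** (2006), §3, Theorem 3.7 (iii), manuscript
pp. 40–41 [cite: MochizukiSemiAnbd2006, Thm 3.7(iii) pp.40-41], with p. 38 "`π₁^temp(𝒢)` is independent,
up to inner automorphism, of the choice".  Final form of the cell's rung-3 reduction: the producer of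
rung 1 (seat abc-iut-L3-t9) delivers `FiniteLevelData 𝒢 c₀` for its own constructed chart `c₀`; the
chart transport (`TemperedChartTransport.lean`) carries the data to every chart, and
`FiniteLevelData.compactInVerticial_of` (`TemperedCompactInVerticialOfLevelData.lean`) concludes.
Print's proof (p. 41: "since the semi-graphs `𝔾_j` are all finite") — and the structure `FiniteLevelData`
(finite level graphs) — cover FINITE `𝔾` (cell ruling φ2 / RQ21): the discharge target of record is the
finite twin `compactInVerticial_of_finite` (the body of `CompactInVerticial` at every finite `𝒢`
satisfying the hypotheses of Thm. 3.7, from the producer statement for finite `𝒢`), with Thm. 3.7 (i),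
(ii) discharged by name (`verticialInjective_holds`, `verticialDistinct_holds`, seat abc-iut-L3-t8).
Proof-only; nothing here takes a side on [IUTchIII] Cor. 3.12.
-/

namespace Literature.AnabelianGeometry.SemiGraphs

namespace ProfiniteSemiGraph

namespace FiniteLevelData

open Topology

universe v u

/-- **`CompactInVerticial` (Theorem 3.7 (iii) as typed) from finite-level data for ONE chart per
semi-graph of anabelioids**, modulo Theorem 3.7 (ii) (`VerticialDistinct`) and Theorem 3.7 (i)
(`VerticialInjective`). [cite: MochizukiSemiAnbd2006, Thm 3.7(iii) pp.40-41] -/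
theorem compactInVerticial_of_one (hVD : VerticialDistinct.{u}) (hVI : VerticialInjective.{u})
    (hD : ∀ (𝒢 : ProfiniteSemiGraph.{u}), 𝒢.Thm37Hypotheses →
      ∃ c₀ : TemperedPiChart 𝒢, Nonempty (FiniteLevelData.{v} 𝒢 c₀)) :
    CompactInVerticial.{u} :=
  compactInVerticial_of hVD hVI fun 𝒢 h𝒢 c => by
    obtain ⟨c₀, h₀⟩ := hD 𝒢 h𝒢
    exact FiniteLevelData.nonempty_of_nonempty h₀ c

/-- **Theorem 3.7 (iii) for FINITE semi-graphs of anabelioids — the finite twin of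
`CompactInVerticial`** (cell ruling φ2: print's proof, p. 41 "since the semi-graphs `𝔾_j` are all
finite", covers finite `𝔾`): for every finite `𝒢` satisfying the hypotheses of Thm. 3.7, every chart `c`
and every compact `C ≤ π₁^temp(𝒢)`, both conjuncts of `CompactInVerticial`, from the producer statement
"finite-level data exist for one chart of every such finite `𝒢`" alone — Thm. 3.7 (i), (ii) being the
theorems `verticialInjective_holds`, `verticialDistinct_holds`. [cite: MochizukiSemiAnbd2006, Thm 3.7(iii) pp.40-41] -/
theorem compactInVerticial_of_finite
    (hD : ∀ (𝒢 : ProfiniteSemiGraph.{u}), 𝒢.Thm37Hypotheses → Finite 𝒢.graph.Vertex →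
      Finite 𝒢.graph.Edge → ∃ c₀ : TemperedPiChart 𝒢, Nonempty (FiniteLevelData.{v} 𝒢 c₀))
    (𝒢 : ProfiniteSemiGraph.{u}) (h𝒢 : 𝒢.Thm37Hypotheses) (hV : Finite 𝒢.graph.Vertex)
    (hE : Finite 𝒢.graph.Edge) (c : TemperedPiChart 𝒢) (C : Subgroup c.G)
    (hC : IsCompact (C : Set c.G)) :
    (∃ (v : 𝒢.graph.Vertex) (H : Subgroup c.G), H ∈ verticialSubgroups c v ∧ C ≤ H) ∧
      (C ≠ ⊥ → ∀ (v₁ v₂ : 𝒢.graph.Vertex) (H₁ H₂ : Subgroup c.G), H₁ ∈ verticialSubgroups c v₁ →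
        H₂ ∈ verticialSubgroups c v₂ → H₁ ≠ H₂ → C ≤ H₁ → C ≤ H₂ →
          (∀ (v₃ : 𝒢.graph.Vertex) (H₃ : Subgroup c.G), H₃ ∈ verticialSubgroups c v₃ → C ≤ H₃ →
              H₃ = H₁ ∨ H₃ = H₂) ∧
          ∃ (e : 𝒢.graph.Edge) (L : Subgroup c.G), 𝒢.graph.IsClosedEdge e ∧
            L ∈ edgeLikeSubgroups c e ∧ C ≤ L) := by
  obtain ⟨c₀, h₀⟩ := hD 𝒢 h𝒢 hV hE
  obtain ⟨D⟩ := FiniteLevelData.nonempty_of_nonempty h₀ c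
  exact FiniteLevelData.compactInVerticial D verticialDistinct_holds h𝒢
    (fun v => (verticialInjective_holds 𝒢 h𝒢 c v).1) C hC

end FiniteLevelData

end ProfiniteSemiGraph

end Literature.AnabelianGeometry.SemiGraphs
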